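import Summits.QuantumAdvantage.QuantumAdvantage.Theorems.RingFrameRingToElimDefs
import Summits.QuantumAdvantage.AdviceFreeQNC0.ProductBound
import Summits.QuantumAdvantage.AdviceFreeQNC0.CrossToProduct
import Summits.QuantumAdvantage.AdviceFreeQNC0.CrossTeamEmbedding
import Summits.QuantumAdvantage.AdviceFreeQNC0.WalkTransport
import HarnessLib

/-!
# Route RingFrame, crux α `RingToElim` (stmt-QuantumAdvantage-19119): the four non-load-bearing
# stubs of the REGISTERED line `product`, by name and signature

The registered skeleton `Cruxes/RingToElim/Lines/product.lean` (skeleton sha `5e71642efee1`,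
`ledger skeleton check` 2026-08-26T07:36Z) has five stubs,

  `stub_LDMA : LDMAPolylog` (load-bearing, OPEN),
  `stub_product : LDMAPolylog → ElimHard → ProductHardPolylog`,
  `stub_crossToProduct : ProductHardPolylog → CrossTeamHardPolylog`,
  `stub_embed : CrossTeamHardPolylog → RingHardU`,
  `stub_transport : RingHardU → Summit.QuantumAdvantage.AdviceFreeQNC0.RingHard 2`,

composed as `RingToElim_of : RingToElim := fun hE => stub_transport (stub_embed (stub_crossToProduct
(stub_product stub_LDMA hE)))`.  The last four are THEOREMS of the cell topic
`Summits/QuantumAdvantage/AdviceFreeQNC0/` (qn-prover gen 0–1; referee REF-ROUND-13…15 PASS):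

* `stub_product`        = `productHard_of_ldma_of_elimHard` (`ProductBound.lean`, p424632),
* `stub_crossToProduct` = `crossTeamHard_of_productHard` (`CrossToProduct.lean`, p420850),
* `stub_embed`          = `ringHardU_of_crossTeamHard` (`CrossTeamEmbedding.lean`, p420460),
* `stub_transport`      = `ringHard_two_of_walkHard` (`WalkTransport.lean`, p419435).

This file states the four stubs under their REGISTERED names with their REGISTERED signatures: the
five proposition names `RingHardU`, `CrossTeamHardPolylog`, `ElimHard`, `ProductHardPolylog`,
`LDMAPolylog` are the route-posited objects of `RingFrameRingToElimDefs.lean` (p446649; bodies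
VERBATIM from the skeleton over the cell topic's token-identical vocabulary `HasDeg`, `wt`, `ringWinU`,
`T4`, `CrossDeg`, `crossWinCount`, `IsElimWin`, `agreeCountR`, `distFail`), and each stub is the
corresponding topic theorem in one line (the terms unify by unfolding one definition).  `ringToElim_of_stub_LDMA` re-composes them exactly as `RingToElim_of` does:
the crux BY NAME from the one open stub `LDMAPolylog` (= `ringToElim_of_ldma`, p425958, with the
hypothesis now called by its registered name).

WHAT THIS IS NOT: not a proof of the crux — `stub_LDMA : LDMAPolylog` is open (for SEPARABLE `Γ` it
is the theorem `ldmaPolylog_separable`, p443768; the non-separable residue is qn-p1's `LDRAgg`,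
Sketch8).  No separation is claimed.
-/

-- the sub-problem namespace `Summit.QuantumAdvantage.QuantumAdvantage` repeats the summit name by design (D-0017)
set_option linter.dupNamespace false

namespace Summit.QuantumAdvantage.QuantumAdvantage.Theorems.RingToElim

open Finset Summit.QuantumAdvantage.AdviceFreeQNC0
open Literature.Computability.MetaComplexity.Smolensky

noncomputable section

/-! ### The four proved stubs, by their registered names and signatures -/

/-- **stub_product** (registered signature): `LDMAPolylog ⟹ ElimHard ⟹ ProductHardPolylog` —
re-staking to a common class, the zero-sum triple, the potential-cost lemma, `μ = κ η₀`
(`productHard_of_ldma_of_elimHard`, `ProductBound.lean`). -/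
theorem stub_product : LDMAPolylog → ElimHard → ProductHardPolylog :=
  fun hL hE => productHard_of_ldma_of_elimHard hL hE

/-- **stub_crossToProduct** (registered signature): `ProductHardPolylog ⟹ CrossTeamHardPolylog` —
the three-mode XOR law, `θ = 1 − μ` (`crossTeamHard_of_productHard`, `CrossToProduct.lean`). -/
theorem stub_crossToProduct : ProductHardPolylog → CrossTeamHardPolylog :=
  fun h => crossTeamHard_of_productHard h

/-- **stub_embed** (registered signature): `CrossTeamHardPolylog ⟹ RingHardU` — a walk strategy on
`n = L + L'` bits aggregates into a cross-team profile with the same win set and cross-degree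
`≤ (log₂ min(L,L'))^{2C}` (`ringHardU_of_crossTeamHard`, `CrossTeamEmbedding.lean`). -/
theorem stub_embed : CrossTeamHardPolylog → RingHardU :=
  fun h => ringHardU_of_crossTeamHard h

/-- **stub_transport** (registered signature): `RingHardU ⟹ RingHard 2` — the trace-form
dictionary ring ↔ walk at charge `n + 2`, `θ = (1 + θ')/2` (`ringHard_two_of_walkHard`,
`WalkTransport.lean`). -/
theorem stub_transport : RingHardU → Summit.QuantumAdvantage.AdviceFreeQNC0.RingHard 2 :=
  fun h => ringHard_two_of_walkHard h

/-- The registered composition `RingToElim_of` with the four proved stubs: the route crux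
`RingToElim` BY NAME from the one open stub `stub_LDMA : LDMAPolylog`. -/
theorem ringToElim_of_stub_LDMA (hLDMA : LDMAPolylog) :
    Summit.QuantumAdvantage.QuantumAdvantage.Theses.RingFrame.RingToElim :=
  fun hE => stub_transport (stub_embed (stub_crossToProduct (stub_product hLDMA hE)))

end

end Summit.QuantumAdvantage.QuantumAdvantage.Theorems.RingToElim
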